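import Summits.ResolutionOfSingularities.ResolutionOfSingularities.Theorems.FrobeniusLadderFInjectiveMacaulayficationE8Forms
import Mathlib.RingTheory.MvPolynomial.Basic
import Mathlib.RingTheory.Ideal.Quotient.Operations
import Mathlib.Logic.Equiv.Fin.Rotate
import HarnessLib

/-!
# K-T4: the key re-embedded specimen `T₁₁⁺ ⊂ 𝔸⁵` is an INTEGRAL complete intersection, and no coordinate vanishes on it

Support file for crux stmt-ResolutionOfSingularities-15315 (`FrobeniusLadder.FInjectiveMacaulayfication`), chain w45a, seat
res-L1-w45a-stub-6 (res-D-pv-018, D→L convert): K-T4 Lean half, inputs (iii) `hprime` and (iv) `hXne` of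
`CIConeFiModelSmooth.ciConeFiModelRel_of_smoothFaceCertificates` (p507224) for idea-1's specimen `T₁₁⁺` (card 4
`f-torific-key-reembedding`; `Sketch-L1-idea-1.lean` §8 `T11plus₁/₂`). [OURS · L1 W4.5a] — NOT a statement of the manuscript
[claim: Hironaka2017]; AI-written, weaker than expert review.

Variables `(x, y, z, w, Φ) = (X 0, …, X 4)` of `k[X] = MvPolynomial (Fin 5) k`; `F₀ = Φ − y² − x³` (the key), `F₁ = z² + Φ³ + x¹¹ + w⁷`
(`T₁₁ = z² + (y²+x³)³ + x¹¹ + w⁷` re-embedded). Over EVERY field `k` (any characteristic):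

* `mk_eq_mk_substKey` / `sub_substKey_mem` — substituting `Φ ↦ y² + x³` (`ψ`) does not change a class modulo `(Φ − y² − x³)`.
* `prime_T11_five` — `g := ψ F₁ = z² + (y²+x³)³ + x¹¹ + w⁷ ∈ k[x,y,z,w,Φ]` is prime and divides no variable and not `y² + x³`:
  `k[X] ≃ k[Y₀..Y₃][T]`, `z ↦ T`, `g ↦ T² + C c`, and `−c` is a non-square since it specialises to `−T⁷`
  (`E8Forms.prime_and_not_dvd_of_ringEquiv`, odd-degree test `mul_self_ne_neg_of_aeval₄`).
* `span_pair_eq_comap` — `(F₀, F₁) = ψ⁻¹ (g)`; hence `isPrime_span_T11plus` — `(F₀, F₁)` is prime — and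
  `mk_X_ne_zero_T11plus` — `x̄ᵥ ≠ 0` in `k[X]/(F₀, F₁)` for every `v`.
* `t11plus_prime_and_X_ne_zero` — packaged for `Fs = ![F₀, F₁]` (`Ideal.span (Set.range Fs)`), the form p507224 consumes.

No definitions, no named facts. [folklore]
-/

-- single-problem summit: the doubled namespace component is forced
set_option linter.dupNamespace false

noncomputable section

namespace Summit.ResolutionOfSingularities.ResolutionOfSingularities.Theorems.FInjectiveMacaulayfication.T11PlusPrime

open MvPolynomial Polynomial
open Summit.ResolutionOfSingularities.ResolutionOfSingularities.Theorems.FInjectiveMacaulayfication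

variable (k : Type) [Field k]

/-! ## §1 The odd-degree non-square test in four variables -/

/-- If `c ∈ k[Y₀, …, Y_{m-1}]` specialises to `−T^(2n+1)` under some `Yᵢ ↦ vᵢ(T)`, then `−c` is not a square:
`a·a = −c` would give a square of odd degree in `k[T]`. [folklore] -/
-- adapted from `E8Forms.mul_self_ne_neg_of_aeval` (the two-variable case)
theorem mul_self_ne_neg_of_aeval' {m : ℕ} {c : MvPolynomial (Fin m) k} (v : Fin m → k[X]) (n : ℕ)
    (hv : MvPolynomial.aeval v c = -(Polynomial.X ^ (2 * n + 1) : k[X])) (a : MvPolynomial (Fin m) k) :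
    a * a ≠ -c := by
  intro h
  have h2 : MvPolynomial.aeval v a * MvPolynomial.aeval v a = (Polynomial.X ^ (2 * n + 1) : k[X]) := by
    rw [← map_mul, h, map_neg, hv, neg_neg]
  have hX : (Polynomial.X ^ (2 * n + 1) : k[X]) ≠ 0 := pow_ne_zero _ Polynomial.X_ne_zero
  have ha : MvPolynomial.aeval v a ≠ 0 := by
    intro h0
    rw [h0, zero_mul] at h2
    exact hX h2.symm
  have h3 := congrArg Polynomial.natDegree h2
  rw [Polynomial.natDegree_mul ha ha, Polynomial.natDegree_X_pow] at h3
  omega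

/-! ## §2 `g = z² + (y²+x³)³ + x¹¹ + w⁷` is prime in `k[x,y,z,w,Φ]` -/

/-- **`g = z² + (y²+x³)³ + x¹¹ + w⁷` is prime in `k[x,y,z,w,Φ]`, divides no variable, and does not divide `y² + x³`** (any field
`k`). Route: `k[X₀..X₄] ≃ k[Y₀..Y₃][T]` with `X 2 ↦ T` (`renameEquiv (finRotate 3)⁻¹`-type reindexing then `finSuccEquiv`),
`g ↦ T² + C c`, `−c` a non-square by the specialisation `Y ↦ (0, 0, −T, 0)` (`−c ↦ … = −T⁷`… precisely `c ↦ −T⁷`).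
[folklore] -/
theorem prime_T11_five (g : MvPolynomial (Fin 5) k)
    (hg : g = MvPolynomial.X 2 ^ 2 + (MvPolynomial.X 1 ^ 2 + MvPolynomial.X 0 ^ 3) ^ 3 + MvPolynomial.X 0 ^ 11 +
      MvPolynomial.X 3 ^ 7) :
    Prime g ∧ (∀ v : Fin 5, ¬ g ∣ MvPolynomial.X v) ∧ ¬ g ∣ (MvPolynomial.X 1 ^ 2 + MvPolynomial.X 0 ^ 3) := by
  -- the reindexing `σ : Fin 5 ≃ Fin 5` with `σ 2 = 0`, `σ 0 = 1`, `σ 1 = 2`, `σ 3 = 3`, `σ 4 = 4`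
  let σ : Fin 5 ≃ Fin 5 := (Equiv.swap (0 : Fin 5) 2).trans (Equiv.swap (1 : Fin 5) 2)
  have hσ2 : σ 2 = 0 := by decide
  have hσ0 : σ 0 = 1 := by decide
  have hσ1 : σ 1 = 2 := by decide
  have hσ3 : σ 3 = 3 := by decide
  have hσ4 : σ 4 = 4 := by decide
  obtain ⟨e, he0, he1, he2, he3, he4⟩ : ∃ e : MvPolynomial (Fin 5) k ≃+* Polynomial (MvPolynomial (Fin 4) k),
      e (MvPolynomial.X 0) = Polynomial.C (MvPolynomial.X 0) ∧ e (MvPolynomial.X 1) = Polynomial.C (MvPolynomial.X 1) ∧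
        e (MvPolynomial.X 2) = Polynomial.X ∧ e (MvPolynomial.X 3) = Polynomial.C (MvPolynomial.X 2) ∧
        e (MvPolynomial.X 4) = Polynomial.C (MvPolynomial.X 3) := by
    refine ⟨((MvPolynomial.renameEquiv k σ).trans (MvPolynomial.finSuccEquiv k 4)).toRingEquiv, ?_, ?_, ?_, ?_, ?_⟩
    · show MvPolynomial.finSuccEquiv k 4 (MvPolynomial.rename σ (MvPolynomial.X 0)) = _
      rw [MvPolynomial.rename_X, hσ0]; exact MvPolynomial.finSuccEquiv_X_succ (j := 0)
    · show MvPolynomial.finSuccEquiv k 4 (MvPolynomial.rename σ (MvPolynomial.X 1)) = _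
      rw [MvPolynomial.rename_X, hσ1]; exact MvPolynomial.finSuccEquiv_X_succ (j := 1)
    · show MvPolynomial.finSuccEquiv k 4 (MvPolynomial.rename σ (MvPolynomial.X 2)) = _
      rw [MvPolynomial.rename_X, hσ2]; exact MvPolynomial.finSuccEquiv_X_zero
    · show MvPolynomial.finSuccEquiv k 4 (MvPolynomial.rename σ (MvPolynomial.X 3)) = _
      rw [MvPolynomial.rename_X, hσ3]; exact MvPolynomial.finSuccEquiv_X_succ (j := 2)
    · show MvPolynomial.finSuccEquiv k 4 (MvPolynomial.rename σ (MvPolynomial.X 4)) = _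
      rw [MvPolynomial.rename_X, hσ4]; exact MvPolynomial.finSuccEquiv_X_succ (j := 3)
  set c : MvPolynomial (Fin 4) k := (MvPolynomial.X 1 ^ 2 + MvPolynomial.X 0 ^ 3) ^ 3 + MvPolynomial.X 0 ^ 11 +
    MvPolynomial.X 2 ^ 7 with hc_def
  have hef : e g = Polynomial.X ^ 2 + Polynomial.C c := by
    subst hg
    simp only [map_add, map_pow, he0, he1, he2, he3, hc_def]
    ring
  -- `-c` is a non-square: specialise `Y₀, Y₁, Y₃ ↦ 0`, `Y₂ ↦ -T`
  have hc : ∀ a : MvPolynomial (Fin 4) k, a * a ≠ -c :=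
    mul_self_ne_neg_of_aeval' k ![0, 0, -Polynomial.X, 0] 3 (by
      rw [hc_def]
      simp only [map_add, map_pow, MvPolynomial.aeval_X, Matrix.cons_val_zero, Matrix.cons_val_one, Matrix.cons_val]
      ring)
  obtain ⟨hp, hnd⟩ := E8Forms.prime_and_not_dvd_of_ringEquiv e g c hef hc
  refine ⟨hp, fun v => ?_, ?_⟩
  · fin_cases v
    · exact hnd (MvPolynomial.X 0) (MvPolynomial.X 0) (MvPolynomial.X_ne_zero 0) he0
    · exact hnd (MvPolynomial.X 1) (MvPolynomial.X 1) (MvPolynomial.X_ne_zero 1) he1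
    · rintro ⟨q, hq⟩
      have h1 : (Polynomial.X ^ 2 + Polynomial.C c : Polynomial (MvPolynomial (Fin 4) k)) ∣ Polynomial.X :=
        ⟨e q, by rw [← hef, ← map_mul, ← hq]; exact he2.symm⟩
      have h2 := Polynomial.natDegree_le_of_dvd h1 Polynomial.X_ne_zero
      rw [Polynomial.natDegree_X_pow_add_C, Polynomial.natDegree_X] at h2
      omega
    · exact hnd (MvPolynomial.X 3) (MvPolynomial.X 2) (MvPolynomial.X_ne_zero 2) he3
    · exact hnd (MvPolynomial.X 4) (MvPolynomial.X 3) (MvPolynomial.X_ne_zero 3) he4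
  · refine hnd _ (MvPolynomial.X 1 ^ 2 + MvPolynomial.X 0 ^ 3) ?_ (by simp only [map_add, map_pow, he0, he1])
    -- `Y₁² + Y₀³ ≠ 0`: its `Y₁²`-coefficient is `1`
    intro h0
    have h := congrArg (MvPolynomial.coeff (Finsupp.single (1 : Fin 4) 2)) h0
    rw [MvPolynomial.coeff_add, MvPolynomial.coeff_zero, MvPolynomial.X_pow_eq_monomial, MvPolynomial.X_pow_eq_monomial,
      MvPolynomial.coeff_monomial, MvPolynomial.coeff_monomial, if_pos rfl, if_neg] at h
    · simp at h
    · intro heq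
      have := congrArg (fun f : Fin 4 →₀ ℕ => f 0) heq
      simp at this

/-! ## §3 Eliminating the key variable: `(F₀, F₁) = ψ⁻¹ (g)` -/

/-- The substitution `ψ : Φ ↦ y² + x³` (other variables fixed) does not change classes modulo `(Φ − y² − x³)`. [folklore] -/
theorem mk_eq_mk_substKey (q : MvPolynomial (Fin 5) k) :
    Ideal.Quotient.mk (Ideal.span {(MvPolynomial.X 4 - (MvPolynomial.X 1 ^ 2 + MvPolynomial.X 0 ^ 3) :
        MvPolynomial (Fin 5) k)})
      (MvPolynomial.aeval (R := k) (fun i : Fin 5 => if i = 4 then (MvPolynomial.X 1 ^ 2 + MvPolynomial.X 0 ^ 3 :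
        MvPolynomial (Fin 5) k) else MvPolynomial.X i) q) =
    Ideal.Quotient.mk (Ideal.span {(MvPolynomial.X 4 - (MvPolynomial.X 1 ^ 2 + MvPolynomial.X 0 ^ 3) :
        MvPolynomial (Fin 5) k)}) q := by
  set I : Ideal (MvPolynomial (Fin 5) k) :=
    Ideal.span {(MvPolynomial.X 4 - (MvPolynomial.X 1 ^ 2 + MvPolynomial.X 0 ^ 3) : MvPolynomial (Fin 5) k)} with hI
  have h : (Ideal.Quotient.mkₐ k I).comp (MvPolynomial.aeval (R := k) (fun i : Fin 5 =>
      if i = 4 then (MvPolynomial.X 1 ^ 2 + MvPolynomial.X 0 ^ 3 : MvPolynomial (Fin 5) k) else MvPolynomial.X i)) =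
      Ideal.Quotient.mkₐ k I := by
    refine MvPolynomial.algHom_ext fun i => ?_
    rw [AlgHom.comp_apply, MvPolynomial.aeval_X, Ideal.Quotient.mkₐ_eq_mk]
    split_ifs with hi
    · subst hi
      rw [eq_comm, Ideal.Quotient.eq]
      exact Ideal.subset_span rfl
    · rfl
  have h' := DFunLike.congr_fun h q
  rw [AlgHom.comp_apply, Ideal.Quotient.mkₐ_eq_mk] at h'
  exact h'

/-- `q − ψ q ∈ (Φ − y² − x³)`. [folklore] -/
theorem sub_substKey_mem (q : MvPolynomial (Fin 5) k) :
    q - MvPolynomial.aeval (R := k) (fun i : Fin 5 => if i = 4 then (MvPolynomial.X 1 ^ 2 + MvPolynomial.X 0 ^ 3 :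
        MvPolynomial (Fin 5) k) else MvPolynomial.X i) q ∈
      Ideal.span {(MvPolynomial.X 4 - (MvPolynomial.X 1 ^ 2 + MvPolynomial.X 0 ^ 3) : MvPolynomial (Fin 5) k)} := by
  rw [← Ideal.Quotient.eq, mk_eq_mk_substKey]

/-- **`(F₀, F₁) = ψ⁻¹ (g)`**: the ideal of `T₁₁⁺` is the preimage under `ψ : Φ ↦ y² + x³` of the principal ideal of
`g = ψ F₁ = z² + (y²+x³)³ + x¹¹ + w⁷`. [folklore] -/
theorem span_pair_eq_comap (F₀ F₁ g : MvPolynomial (Fin 5) k)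
    (hF₀ : F₀ = MvPolynomial.X 4 - MvPolynomial.X 1 ^ 2 - MvPolynomial.X 0 ^ 3)
    (hF₁ : F₁ = MvPolynomial.X 2 ^ 2 + MvPolynomial.X 4 ^ 3 + MvPolynomial.X 0 ^ 11 + MvPolynomial.X 3 ^ 7)
    (hg : g = MvPolynomial.X 2 ^ 2 + (MvPolynomial.X 1 ^ 2 + MvPolynomial.X 0 ^ 3) ^ 3 + MvPolynomial.X 0 ^ 11 +
      MvPolynomial.X 3 ^ 7) :
    Ideal.span {F₀, F₁} = (Ideal.span {g}).comap (MvPolynomial.aeval (R := k) (fun i : Fin 5 =>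
      if i = 4 then (MvPolynomial.X 1 ^ 2 + MvPolynomial.X 0 ^ 3 : MvPolynomial (Fin 5) k) else MvPolynomial.X i)).toRingHom := by
  set ψ := (MvPolynomial.aeval (R := k) (fun i : Fin 5 =>
      if i = 4 then (MvPolynomial.X 1 ^ 2 + MvPolynomial.X 0 ^ 3 : MvPolynomial (Fin 5) k) else MvPolynomial.X i)) with hψ
  have hψX : ∀ i : Fin 5, ψ (MvPolynomial.X i) =
      if i = 4 then (MvPolynomial.X 1 ^ 2 + MvPolynomial.X 0 ^ 3 : MvPolynomial (Fin 5) k) else MvPolynomial.X i :=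
    fun i => MvPolynomial.aeval_X _ i
  have hψ0 : ψ F₀ = 0 := by
    rw [hF₀]
    simp only [map_sub, map_pow, hψX]
    simp
  have hψ1 : ψ F₁ = g := by
    rw [hF₁, hg]
    simp only [map_add, map_pow, hψX]
    simp
  have hF₀' : Ideal.span {(MvPolynomial.X 4 - (MvPolynomial.X 1 ^ 2 + MvPolynomial.X 0 ^ 3) : MvPolynomial (Fin 5) k)} ≤
      Ideal.span {F₀, F₁} := by
    rw [Ideal.span_singleton_le_iff_mem]
    have : (MvPolynomial.X 4 - (MvPolynomial.X 1 ^ 2 + MvPolynomial.X 0 ^ 3) : MvPolynomial (Fin 5) k) = F₀ := by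
      rw [hF₀]; ring
    rw [this]
    exact Ideal.subset_span (Set.mem_insert _ _)
  apply le_antisymm
  · rw [Ideal.span_le]
    intro q hq
    simp only [Set.mem_insert_iff, Set.mem_singleton_iff] at hq
    rw [SetLike.mem_coe, Ideal.mem_comap]
    change ψ q ∈ Ideal.span {g}
    rcases hq with rfl | rfl
    · rw [hψ0]; exact Ideal.zero_mem _
    · rw [hψ1]; exact Ideal.mem_span_singleton_self g
  · intro q hq
    rw [Ideal.mem_comap] at hq
    change ψ q ∈ Ideal.span {g} at hq
    obtain ⟨h, hh⟩ := Ideal.mem_span_singleton'.mp hq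
    -- `q = (q − ψ q) + h·g`, `g = F₁ − (F₁ − ψ F₁)`
    have h1 : q - ψ q ∈ Ideal.span {F₀, F₁} := hF₀' (sub_substKey_mem k q)
    have h2 : g ∈ Ideal.span {F₀, F₁} := by
      have h3 : F₁ - ψ F₁ ∈ Ideal.span {F₀, F₁} := hF₀' (sub_substKey_mem k F₁)
      have h4 : F₁ ∈ Ideal.span {F₀, F₁} := Ideal.subset_span (Set.mem_insert_of_mem _ rfl)
      have := Ideal.sub_mem _ h4 h3
      rwa [sub_sub_cancel, hψ1] at this
    have h5 : ψ q ∈ Ideal.span {F₀, F₁} := by rw [← hh]; exact Ideal.mul_mem_left _ _ h2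
    have := Ideal.add_mem _ h1 h5
    rwa [sub_add_cancel] at this

/-- **`(F₀, F₁)` is a prime ideal of `k[x,y,z,w,Φ]`** for `F₀ = Φ − y² − x³`, `F₁ = z² + Φ³ + x¹¹ + w⁷`, over every field `k`:
`T₁₁⁺ = V(F₀, F₁)` is an integral complete intersection (the key re-embedding of the hypersurface `T₁₁`). [folklore] -/
theorem isPrime_span_T11plus (F₀ F₁ : MvPolynomial (Fin 5) k)
    (hF₀ : F₀ = MvPolynomial.X 4 - MvPolynomial.X 1 ^ 2 - MvPolynomial.X 0 ^ 3)
    (hF₁ : F₁ = MvPolynomial.X 2 ^ 2 + MvPolynomial.X 4 ^ 3 + MvPolynomial.X 0 ^ 11 + MvPolynomial.X 3 ^ 7) :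
    (Ideal.span ({F₀, F₁} : Set (MvPolynomial (Fin 5) k))).IsPrime := by
  obtain ⟨hp, -, -⟩ := prime_T11_five k _ rfl
  rw [span_pair_eq_comap k F₀ F₁ _ hF₀ hF₁ rfl]
  haveI : (Ideal.span {(MvPolynomial.X 2 ^ 2 + (MvPolynomial.X 1 ^ 2 + MvPolynomial.X 0 ^ 3) ^ 3 +
      MvPolynomial.X 0 ^ 11 + MvPolynomial.X 3 ^ 7 : MvPolynomial (Fin 5) k)}).IsPrime :=
    (Ideal.span_singleton_prime hp.ne_zero).mpr hp
  exact Ideal.comap_isPrime _ _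

/-- **No coordinate vanishes on `T₁₁⁺`**: `x̄ᵥ ≠ 0` in `k[x,y,z,w,Φ]/(F₀, F₁)` for every `v` (`ψ xᵥ = xᵥ` for `v ≠ Φ` and
`ψ Φ = y² + x³`, none divisible by the prime `g`). [folklore] -/
theorem mk_X_ne_zero_T11plus (F₀ F₁ : MvPolynomial (Fin 5) k)
    (hF₀ : F₀ = MvPolynomial.X 4 - MvPolynomial.X 1 ^ 2 - MvPolynomial.X 0 ^ 3)
    (hF₁ : F₁ = MvPolynomial.X 2 ^ 2 + MvPolynomial.X 4 ^ 3 + MvPolynomial.X 0 ^ 11 + MvPolynomial.X 3 ^ 7) (v : Fin 5) :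
    Ideal.Quotient.mk (Ideal.span ({F₀, F₁} : Set (MvPolynomial (Fin 5) k))) (MvPolynomial.X v) ≠ 0 := by
  obtain ⟨-, hX, hkey⟩ := prime_T11_five k _ rfl
  rw [Ne, Ideal.Quotient.eq_zero_iff_mem, span_pair_eq_comap k F₀ F₁ _ hF₀ hF₁ rfl, Ideal.mem_comap]
  change ¬ MvPolynomial.aeval (R := k) (fun i : Fin 5 => if i = 4 then (MvPolynomial.X 1 ^ 2 + MvPolynomial.X 0 ^ 3 :
      MvPolynomial (Fin 5) k) else MvPolynomial.X i) (MvPolynomial.X v) ∈ Ideal.span {_}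
  rw [MvPolynomial.aeval_X, Ideal.mem_span_singleton]
  split_ifs with hv
  · exact hkey
  · exact hX v

/-! ## §4 Packaged for `Fs = ![F₀, F₁]` -/

/-- **`T₁₁⁺` inputs (iii) `hprime` and (iv) `hXne` of `CIConeFiModelSmooth.ciConeFiModelRel_of_smoothFaceCertificates`**: for
`Fs = ![Φ − y² − x³, z² + Φ³ + x¹¹ + w⁷]` over any field, `Ideal.span (Set.range Fs)` is prime and every `x̄ᵥ ≠ 0`. [folklore] -/
theorem t11plus_prime_and_X_ne_zero (Fs : Fin 2 → MvPolynomial (Fin 5) k)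
    (hF₀ : Fs 0 = MvPolynomial.X 4 - MvPolynomial.X 1 ^ 2 - MvPolynomial.X 0 ^ 3)
    (hF₁ : Fs 1 = MvPolynomial.X 2 ^ 2 + MvPolynomial.X 4 ^ 3 + MvPolynomial.X 0 ^ 11 + MvPolynomial.X 3 ^ 7) :
    (Ideal.span (Set.range Fs)).IsPrime ∧
      ∀ v : Fin 5, Ideal.Quotient.mk (Ideal.span (Set.range Fs)) (MvPolynomial.X v) ≠ 0 := by
  have hrange : Set.range Fs = {Fs 0, Fs 1} := by
    ext q
    simp only [Set.mem_range, Set.mem_insert_iff, Set.mem_singleton_iff]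
    constructor
    · rintro ⟨i, rfl⟩; fin_cases i <;> simp
    · rintro (rfl | rfl); exacts [⟨0, rfl⟩, ⟨1, rfl⟩]
  rw [hrange]
  exact ⟨isPrime_span_T11plus k (Fs 0) (Fs 1) hF₀ hF₁, mk_X_ne_zero_T11plus k (Fs 0) (Fs 1) hF₀ hF₁⟩

end Summit.ResolutionOfSingularities.ResolutionOfSingularities.Theorems.FInjectiveMacaulayfication.T11PlusPrime

end
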